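import Mathlib
import Summits.RiemannHypothesis.RiemannHypothesis.Theorems.ScrewManifestCertDefs
import Summits.RiemannHypothesis.RiemannHypothesis.Theorems.ScrewManifestMargin

/-!
# RH-FREE: the corner-cost / plateau skeleton of `SuperlinearFloor` (sos-theory g19, 2026-08-26;
HOME/sos/lean/ScrewManifestCornerLaw.lean — landable verbatim as `Theorems/ScrewManifestCornerLaw.lean`)

Memo `HOME/sos/theory/SCREW-P3-NEARBAND-MODEL-g19.md` §4–§6.  The near-band LP model NB(M,θ) computes
that at fixed slope `θ = T/M` the off-diagonal mass a manifest certificate must leave in the top rows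
grows like `(log M)·e^{−θ}/√θ` (corner of the screw cusp `(|s|/2)·log M` rounded inside the lattice gap
`|s| < 1`; Eremenko–Yuditskii 2007), while the diagonal budget (the plateau `diag·M ≈ 0.23`) does not
grow.  This file TYPES the two analytic inputs as RH-free `Prop` slots and PROVES the assembly

  `CornerCostLaw → PlateauBound → SuperlinearFloor`.

* `PlateauBound`  (S2, the crux): at height `≤ θ·(n+1)` every strictly-DD manifest remainder has
  diagonal entries `≤ A_θ/(n+1)` on the rows `i` with `n ≤ 4(i+2)` (the top three quarters by node).
* `CornerCostLaw` (S1, analytic): given such a diagonal bound, SOME row has DD-deficit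
  `Σ_{j≠i}|R_ij| − R_ii ≥ (c_θ·log(n+1) − C)/(n+1)` with `c_θ > 0`.
Neither slot asserts a constant; both are statements about the certificate FORMAT for truncated
screw matrices and the RH-free function `zetaScrew`.  Nothing here bears on the truth of RH.
-/

-- `Summit.RiemannHypothesis.RiemannHypothesis.…` duplicates `RiemannHypothesis` BY DESIGN (D-0017).
set_option linter.dupNamespace false
set_option autoImplicit false

namespace Summit.RiemannHypothesis.RiemannHypothesis.Theorems.IntegerScrew.Manifest

open Finset

/-- RH-FREE conjecture slot S2 (PLATEAU BOUND; memo §5): at slope `θ` the diagonal of any strictly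
diagonally dominant manifest remainder is `O_θ(1/(n+1))` on every row `i` with `n ≤ 4·(i+2)`.
Census: `diag·M ∈ [0.220, 0.240]` on the top rows for `M = 32 … 192` (flat).  Why it might fail: a
certificate family with large positive node errors on the top nodes paid for in the far band. -/
def PlateauBound : Prop :=
  ∀ θ : ℝ, 0 < θ → ∃ A : ℝ, ∀ (n K : ℕ) (t w : Fin K → ℝ) (wJ : ℝ),
    (∀ k, 0 < t k ∧ t k ≤ θ * (n + 1) ∧ 0 ≤ w k) → 0 ≤ wJ →
      IsStrictDiagDominant (remainder n K t w wJ) →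
        ∀ i : Fin n, n ≤ 4 * ((i : ℕ) + 2) → remainder n K t w wJ i i ≤ A / (n + 1)

/-- RH-FREE conjecture slot S1 (CORNER COST LAW; memo §4): at slope `θ`, under a diagonal bound
`A/(n+1)` on the rows `n ≤ 4(i+2)`, some row of the manifest remainder has off-diagonal mass exceeding
its diagonal by `(c·log(n+1) − C)/(n+1)`, `c > 0` (model: `c ≍ e^{−θ}/√θ`; `1 ≤ n` keeps `Fin n`
nonempty, small `n` are absorbed by `C`).  Why it might fail: the
node-error freedom (one diagonal per column) could absorb more of the corner than the plateau model
allows — tested by ADDENDUM D's NN·M(255) number. -/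
def CornerCostLaw : Prop :=
  ∀ θ A : ℝ, 0 < θ → ∃ c C : ℝ, 0 < c ∧ ∀ (n K : ℕ) (t w : Fin K → ℝ) (wJ : ℝ), 1 ≤ n →
    (∀ k, 0 < t k ∧ t k ≤ θ * (n + 1) ∧ 0 ≤ w k) → 0 ≤ wJ →
      (∀ i : Fin n, n ≤ 4 * ((i : ℕ) + 2) → remainder n K t w wJ i i ≤ A / (n + 1)) →
        ∃ i : Fin n, (c * Real.log (n + 1) - C) / (n + 1)
          ≤ (∑ j ∈ univ.erase i, |remainder n K t w wJ i j|) - remainder n K t w wJ i i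

/-- **Assembly (RH-FREE, proved): the corner cost law and the plateau bound imply the superlinear
floor.**  For slope `C` work at `θ = max C 1`; a certificate at height `C(n+1)` is one at height
`θ(n+1)` (`manifestCert_mono`); S2 bounds its diagonals, S1 then yields a row whose DD-deficit is
`≥ (c log(n+1) − C')/(n+1)`, which is positive once `log(n+1) > C'/c` — contradicting strict diagonal
dominance. -/
theorem superlinearFloor_of_cornerCostLaw (h1 : CornerCostLaw) (h2 : PlateauBound) :
    SuperlinearFloor := by
  intro C
  set θ : ℝ := max C 1 with hθdef
  have hθ : 0 < θ := lt_of_lt_of_le one_pos (le_max_right _ _)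
  obtain ⟨A, hA⟩ := h2 θ hθ
  obtain ⟨c, C', hc, hcost⟩ := h1 θ A hθ
  obtain ⟨n₀, hn₀⟩ : ∃ n₀ : ℕ, C' / c < Real.log ((n₀ : ℝ) + 1) := by
    obtain ⟨n₀, hn₀⟩ := exists_nat_gt (Real.exp (C' / c))
    refine ⟨n₀, ?_⟩
    have h' : Real.exp (C' / c) < (n₀ : ℝ) + 1 := by linarith
    calc C' / c = Real.log (Real.exp (C' / c)) := (Real.log_exp _).symm
      _ < Real.log ((n₀ : ℝ) + 1) := Real.log_lt_log (Real.exp_pos _) h'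
  refine ⟨n₀ + 1, fun n hn tmin htmin hcert => ?_⟩
  have hn1 : (0 : ℝ) < (n : ℝ) + 1 := by positivity
  have hn_one : 1 ≤ n := le_trans (Nat.le_add_left 1 n₀) hn
  have hcert' : ManifestCert n tmin (θ * (n + 1)) :=
    manifestCert_mono le_rfl (mul_le_mul_of_nonneg_right (le_max_left _ _) hn1.le) hcert
  obtain ⟨K, t, w, wJ, hatoms, hwJ, hDD⟩ := hcert'
  have hat' : ∀ k, 0 < t k ∧ t k ≤ θ * (n + 1) ∧ 0 ≤ w k :=
    fun k => ⟨(hatoms k).2.2.1, (hatoms k).2.1, (hatoms k).2.2.2⟩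
  have hdiag := hA n K t w wJ hat' hwJ hDD
  obtain ⟨i, hi⟩ := hcost n K t w wJ hn_one hat' hwJ hdiag
  have hrow := hDD i
  -- the deficit of row `i` is negative by strict diagonal dominance …
  have hneg : (c * Real.log (n + 1) - C') / (n + 1) < 0 := lt_of_le_of_lt hi (by linarith)
  -- … but positive for `n ≥ n₀`.
  have hlog : C' / c < Real.log ((n : ℝ) + 1) := by
    refine lt_of_lt_of_le hn₀ (Real.log_le_log (by positivity) ?_)
    have : n₀ ≤ n := le_trans (Nat.le_succ n₀) hn
    exact_mod_cast Nat.succ_le_succ this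
  have hpos : 0 < c * Real.log (n + 1) - C' := by
    have := (div_lt_iff₀ hc).mp hlog
    linarith
  have : 0 < (c * Real.log (n + 1) - C') / (n + 1) := div_pos hpos hn1
  linarith

end Summit.RiemannHypothesis.RiemannHypothesis.Theorems.IntegerScrew.Manifest
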